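import Summits.BirchSwinnertonDyer.Rank1Residual.GaloisImage.KolyvaginLevelOneTorsionCorner
import Summits.BirchSwinnertonDyer.Rank1Residual.GaloisImage.KolyvaginStubVanishingRat
import Summits.BirchSwinnertonDyer.Rank1Residual.GaloisImage.KuriharaLowerBoundAssembly
import HarnessLib

/-!
# END-m1, "nine divides Ш", in `3`-Selmer currency: on a non-unit level-one row, DICT3₁ and ONE
# level with a non-vanishing Kurihara number give a non-zero `3`-Selmer class
# (cell `b2b-bsdres`, team n1011, ROUTE-1 §33.3 sub-target R1-57, FILE A; row T-R1-57-A, seat p09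
# GEN 6; skeleton `cells/n1011/skel/T-R1-57-A.md`; FILE B = n1011-p18's record corollary)

HONEST FRAMING (cell `b2b-bsdres`, run/shared/lean/b2b/bsd-rank1-residual/, verbatim in every
file): the goal of the cell is to DELETE the COMBINATION-SHAPED residual classes of the
Birch–Swinnerton-Dyer formula for ALL analytic-rank `≤ 1` elliptic curves over `ℚ` — "full BSD
formula for every rank `≤ 1` curve in class `C`" assembled STRICTLY from published theorems — so
that the rank-`≤ 1` remainder becomes exactly the CONSTRUCTION-SHAPED classes, which are TYPED
(missing-input `Prop`s), NOT attempted. This is not "finishing BSD". Team n1011 (N10/N11, the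
additive block `X4 ∧ p = 3`): research route on the CONSTRUCTION-SHAPED class X4 (§I N11, class A1
= `#E(ℚ₃)[3] = 1` rows); no claim beyond the stated classes; the label X4 and the mark of RESIDUAL-MAP
§I N11 are UNCHANGED by this file; nothing is booked. Theorems only: no definition, no named fact,
no `sorry`. END-m1 is WEAKER than the deep socket E2 (it gives `Ш[3] ≠ 0`, i.e. `X ≥ 2` after
Cassels–Tate, not `X ≥ v`): DEBT REDUCTION on the rows where the two coincide, NOT coverage; the
PORT DICT3₁ (`KatoKuriharaDictionaryThreeOneAt W 0 D v₃`, construction-shaped) and the injectivity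
input `hinj` (n1011-p11's G5, in flight; interim [S24] in `…_of_S24`) are HYPOTHESES.

## What and why (r1 ROUTE-1 §33.0 (γ) / §33.3)

The injectivity half of R1-56 (n1011-p11's END G5 `CoreRankOne.apply_eq_zero_of_apply_core_eq_zero`,
the step carrying the located four-class swap of [MR04] Prop. 4.3.11 / [S24] Lemma 6.4) had no
END-level consumer. END-m1 is one: for `E/ℚ` additive at `3` with `3 ∤ c₃`, `ρ̄_{E,3}` onto,
`#E(ℚ₃)[3] = 1`, a modular parametrisation with `3 ∤ c_P` and the unit period transfer, and
`3 ∣ [0]⁺ = L(E,1)/Ω⁺_f mod 3` (every N11 LOWER@3 row), the level-one dictionary DICT3₁ for a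
Kolyvagin datum `D` on `E[3]` together with ONE level `n ∈ 𝒩` whose Kurihara number
`δ̃_n ≢ 0 (mod 3)` — NO sub-level vanishing, NO parity, ANY `ν(n)` — force `Sel₃(E/ℚ) ≠ 0`
(hence, in FILE B: `Ш(E)[3] ≠ 0` by rank `0` and `E(ℚ)[3] = 0`, `9 ∣ #Ш(E)[3^∞]` by Cassels–Tate).

* §A `forall_apply_eq_zero_of_congruence_of_forall_subset` (generic, the one new lemma):
  UNITRIANGULARITY of the (I4) bridge — if `κ'_d − κ₀ d ∈ ℤ-span{κ₀ c : c ⊊ d}` at every level and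
  `κ'` vanishes on every level `c ⊆ n`, then so does `κ₀`; contrapositive
  `exists_subset_apply_ne_zero_of_congruence`.  This REPLACES the sub-level vanishing `hv` of the deep
  sockets: a row certifies at its CHEAPEST non-vanishing level.
* §B MAIN `exists_ne_zero_mem_selmerGroup_three_of_dictionaryOne_of_levelOne_certificate` (proof = r1
  §33.3 steps (1)–(4)): (1) DICT3₁ gives `κ₀, Λ, κ'`; at `∅`, `δ̃_1 = [0]⁺ ≡ 0` makes `κ'_∅` a
  `3`-Selmer class (n1011-p13 `apply_empty_mem_selmerGroup_kummer_of_dictionary_of_delta_eq_zero`); at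
  `n`, `Λ(loc_{v₃} κ₀ n) = u·3⁰·δ̃_n(ψ) ≠ 0` (`ψ`-independence `kuriharaNumber_eq_zero_iff_of_surjective`),
  so `κ₀ n ≠ 0` and by §A `κ'_c ≠ 0` at some level `c ⊆ n`; (2) if `κ'_∅ ≠ 0` we are done; (3) if
  `κ'_∅ = 0` and `H¹_{𝓕̄_can^*} = 0` (`∅` a core vertex), `hinj` kills `κ'` — contradiction; (4) if
  `H¹_{𝓕̄_can^*} ≠ 0`, the core rank (`#H¹_{𝓕̄_can} = 3·#H¹_{𝓕̄_can^*}`, n1011-p13/p04's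
  `hasCoreRank_one_propagatedSelmerStructureOne_of_isPerfect_of_localEuler`, a theorem modulo `hEP`;
  both groups finite by `KolyvaginStubVanishingRat`) gives `#H¹_{𝓕̄_can} ≥ 6`, while the DICTIONARY'S
  OWN functional `Λ ∘ loc_{v₃} : H¹_{𝓕̄_can} → ℤ/3` has kernel inside `Sel₃` (kernel clause + p13's
  `mem_selmerGroup_kummer_of_mem_propagated_of_localization_mem`) — so `Sel₃` has `≥ 2` elements.  NO
  (Lp) count binder, NO `hunro`, NO GZK, NO tower, NO `inv′`, NO `hS24`/`hS24₂`.
* `natCard_selmerGroup_three_ne_one_…` — the `W.selmerGroup 3` counting reading FILE B consumes.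
* Sequel `KolyvaginLevelOneNineDividesOfS24.lean` — the INTERIM: `hinj` discharged from the bijectivity
  clause of n1011-p13's LANDED residual instance over the pinned fact `hS24` (+ `hunro`), until
  n1011-p11's G5 lands (then a one-binder swap makes END-m1 [S24]-free).

References: r1 `cells/n1011/ROUTE-1.md` §33.3; [Rubin2011] Thm. 2.8.4, Cor. 2.8.9 (pp. 25–26);
[MazurRubin2004] Thm. 4.3.4, Thm. 4.4.1, App. A (33); [Kim2022StructureSelmer] Thm. 3.13, §3.4.1;
[Kurihara2014] §1.1; [Sakamoto2024] Thm. 4.4 (1) (p. 926).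
-/

noncomputable section

open scoped Classical NumberField ContRepresentation
open Field NumberField IsDedekindDomain
open WeierstrassCurve Literature.NumberTheory.EllipticCurves Literature.NumberTheory.EllipticCurves.ModularForms
  Literature.NumberTheory.EllipticCurves.Rank1Residual
  Literature.NumberTheory.EllipticCurves.Rank1Residual.Typed
  Literature.NumberTheory.GaloisRepresentations
  Literature.NumberTheory.GaloisRepresentations.DiscreteGaloisModule Literature.NumberTheory.GaloisCohomology
open Literature.NumberTheory.DiophantineGeometry.Dioph (ratModP)

namespace Summit.BirchSwinnertonDyer.Rank1Residual.GaloisImage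

/-! ## §A. Unitriangularity of the (I4) bridge -/

section Unitriangular

variable {K : Type} [Field K] [NumberField K] {M : Type} [AddCommGroup M] [TopologicalSpace M]
  [DiscreteTopology M] {ρ : DiscreteGaloisModule K M}

/-- **Unitriangularity of the Mazur–Rubin / Kim (I4) bridge.**  If two families `κ₀`, `κ'` of
classes satisfy `κ'_d − κ₀ d ∈ ℤ-span{κ₀ c : c ⊊ d}` at every level `d` of a Kolyvagin datum (the
(I4) clause of the cell's dictionary `KatoKuriharaDictionaryThreeOneAt`: [MR04] App. A (33) / [K22]
§2.2), and `κ'` vanishes at every level `c ⊆ n`, then `κ₀` vanishes at every level `c ⊆ n` —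
strong induction on `c`: the span of a set of zeros is zero.
[cite: MazurRubin2004, App. A (33)] [cite: Kim2022StructureSelmer, §2.2 and Thm. 3.13] -/
theorem forall_apply_eq_zero_of_congruence_of_forall_subset {D : KolyvaginDatum ρ}
    (κ₀ κ' : Finset (HeightOneSpectrum (𝓞 K)) → galoisCohomology ρ 1)
    (hI4 : ∀ d, D.IsLevel d → κ' d - κ₀ d ∈ AddSubgroup.closure {x | ∃ c, c ⊂ d ∧ x = κ₀ c})
    {n : Finset (HeightOneSpectrum (𝓞 K))} (hn : D.IsLevel n)
    (h0 : ∀ c, c ⊆ n → κ' c = 0) : ∀ c, c ⊆ n → κ₀ c = 0 := by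
  intro c
  induction c using Finset.strongInduction with
  | H c ih =>
    intro hcn
    have hc : D.IsLevel c := fun q hq => hn (Finset.coe_subset.2 hcn hq)
    -- every strictly smaller level has `κ₀ = 0`, so the span in (I4) is `⊥`
    have hbot : AddSubgroup.closure {x : galoisCohomology ρ 1 | ∃ c', c' ⊂ c ∧ x = κ₀ c'} = ⊥ := by
      rw [eq_bot_iff, AddSubgroup.closure_le]
      rintro x ⟨c', hc', rfl⟩
      rw [SetLike.mem_coe, AddSubgroup.mem_bot]
      exact ih c' hc' (hc'.1.trans hcn)
    have h := hI4 c hc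
    rw [hbot, AddSubgroup.mem_bot, h0 c hcn, zero_sub, neg_eq_zero] at h
    exact h

/-- **A non-zero `κ₀ n` forces a non-zero `κ'_c` at some level `c ⊆ n`** (contrapositive of
`forall_apply_eq_zero_of_congruence_of_forall_subset`): with the (I4) bridge, a certificate at ANY
level `n` — whatever happens at the sub-levels — produces a level `c ⊆ n` (again a level of `D`) where
the Kolyvagin system itself is non-zero.  No sub-level vanishing, no parity, no condition on the
number of primes of `n`. [cite: MazurRubin2004, App. A (33)] [cite: Kim2022StructureSelmer, Thm. 3.13] -/
theorem exists_subset_apply_ne_zero_of_congruence {D : KolyvaginDatum ρ}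
    (κ₀ κ' : Finset (HeightOneSpectrum (𝓞 K)) → galoisCohomology ρ 1)
    (hI4 : ∀ d, D.IsLevel d → κ' d - κ₀ d ∈ AddSubgroup.closure {x | ∃ c, c ⊂ d ∧ x = κ₀ c})
    {n : Finset (HeightOneSpectrum (𝓞 K))} (hn : D.IsLevel n) (hne : κ₀ n ≠ 0) :
    ∃ c, c ⊆ n ∧ D.IsLevel c ∧ κ' c ≠ 0 := by
  by_contra h
  push Not at h
  refine hne (forall_apply_eq_zero_of_congruence_of_forall_subset κ₀ κ' hI4 hn (fun c hc => ?_) n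
    subset_rfl)
  exact h c hc fun q hq => hn (Finset.coe_subset.2 hc hq)

end Unitriangular

/-! ## §B. END-m1 in `3`-Selmer currency -/

variable (W : WeierstrassCurve ℚ) [W.IsElliptic]

/-- **END-m1 — the level-one NON-UNIT lower end: DICT3₁ + `3 ∣ [0]⁺` + ONE level with a non-zero
Kurihara number + injectivity at the core vertex `∅` ⟹ `Sel₃(E/ℚ) ≠ 0`.**  Setting = n1011-p13's
EXOTIC unit-case END (`KolyvaginLevelOneUnitCaseOfDictionary`): `W/ℚ` globally minimal, additive at
`3` with `3 ∤ c₃`, `ρ̄_{E,3}` onto, `#E(ℚ₃)[3] = 1`, a Poitou–Tate family `inv` ×3, Tate's `hEP`,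
a finite `S ⊇ {3} ∪ {bad}`, ANY Kolyvagin datum `D` on `E[3]` (its shape — Sakamoto's primes `𝒫(τ)`,
the transverse conditions, the comparison maps — matters only for DISCHARGING `hinj`, see
`…_of_S24`), `v₃ ∣ 3`, THE PORT `KatoKuriharaDictionaryThreeOneAt W 0 D v₃`, a modular
parametrisation `P` with `3 ∤ c_P` and the unit period transfer.  NEW w.r.t. the unit case: `hzero : [0]⁺ ≡ 0 (mod 3)` (the NON-unit rows); a
CERTIFICATE at ONE level `n ∈ 𝒩` — a surjective logarithm system `ψ₀` at the primes of `n` and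
`δ̃_n(ψ₀) ≢ 0 (mod 3)` (NO sub-level vanishing, NO parity, ANY `ν(n)`); and `hinj` = n1011-p11's END G5
`CoreRankOne.apply_eq_zero_of_apply_core_eq_zero` at `n₀ = ∅` (a Kolyvagin system for
`(E[3], 𝓕̄_can, 𝒫)` vanishing at the core vertex `∅` vanishes everywhere; [S24] Prop. 7.6 / [MR04]
Thm. 4.4.1 Case 3 — interim discharge from `hS24` in `…_of_S24`).  CONCLUSION: a NON-ZERO class in
`Sel^{(3)}(E/ℚ) = H¹_𝓚(ℚ, E[3])`.  Proof: r1 ROUTE-1 §33.3 (1)–(4) with §A (file docstring).  Binders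
(nothing hidden): as listed; NO (Lp) count (the index `3` at `v₃` is read through the dictionary's own
`Λ`), NO `hunro`, NO GZK, NO tower, NO `inv′`, NO `hS24`/`hS24₂`.  Nothing booked; X4 stays
CONSTRUCTION-SHAPED; no mark / label changed.
[cite: Kim2022StructureSelmer, Thm. 3.13 and §3.4.1] [cite: Rubin2011, Thm. 2.8.4 and Cor. 2.8.9 (pp. 25–26)]
[cite: MazurRubin2004, Thm. 4.4.1 and App. A (33)] [cite: Kurihara2014, §1.1 (PDF p. 2)] -/
theorem exists_ne_zero_mem_selmerGroup_three_of_dictionaryOne_of_levelOne_certificate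
    [W.IsGloballyMinimal] [Finite (geomTorsion W ((3 : ℕ) : ℤ))]
    (h3 : W.HasSurjectiveModNGaloisRep ((3 : ℕ) : ℤ))
    (inv : LocalInvariants ℚ 3) (hperf : inv.IsPerfect) (hsum : inv.SumLocalTermEqZero)
    (hcompl : inv.SelmerComplement)
    (hEP : ∀ v : HeightOneSpectrum (𝓞 ℚ), localEulerPoincareCharacteristic (v.adicCompletion ℚ))
    (S : Finset (Place ℚ))
    (h3S : ∀ v : HeightOneSpectrum (𝓞 ℚ), ((3 : ℕ) : 𝓞 ℚ) ∈ v.asIdeal → (Sum.inr v : Place ℚ) ∈ S)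
    (hbadS : ∀ v : HeightOneSpectrum (𝓞 ℚ), ¬ W.HasGoodReductionAt v → (Sum.inr v : Place ℚ) ∈ S)
    (D : KolyvaginDatum (W.torsionGaloisModule ((3 : ℕ) : ℤ)))
    (v₃ : HeightOneSpectrum (𝓞 ℚ)) (hv₃ : ((3 : ℕ) : 𝓞 ℚ) ∈ v₃.asIdeal)
    (hDict : KatoKuriharaDictionaryThreeOneAt W 0 D v₃)
    (hX : Addv W 3) (hc3 : ¬ 3 ∣ (W.baseChange ℚ_[3]).localTamagawaNumber ℤ_[3])
    (ht : Nat.card {Q : (W.baseChange ℚ_[3]).toAffine.Point // (3 : ℕ) • Q = 0} = 1)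
    {N : ℕ} [NeZero N] (P : ModularParametrizationData W N)
    (hManin : ¬ ((3 : ℕ) : ℤ) ∣ P.maninConstant)
    (hΩ : ∃ u : ℚ, ‖(u : ℚ_[3])‖ = 1 ∧ W.realPeriodRat = u * plusPeriod P.f)
    (hzero : ratModP 3 (ratPlusSymbol P.f 0) = 0)
    -- the certificate: ONE level `n` with a non-vanishing Kurihara number
    (n : Finset (HeightOneSpectrum (𝓞 ℚ))) (hn : D.IsLevel n)
    {ψ₀ : (ℓ : ℕ) → (ZMod ℓ)ˣ →* Multiplicative (ZMod 3)}
    (hψ₀ : ∀ q ∈ n, Function.Surjective (ψ₀ (Ideal.absNorm q.asIdeal)))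
    (hcert : haveI : NeZero (∏ q ∈ n, Ideal.absNorm q.asIdeal) :=
        ⟨Finset.prod_ne_zero_iff.2 fun q _ => Assembly.absNorm_ne_zero q⟩
      kuriharaNumber P.f 3 (∏ q ∈ n, Ideal.absNorm q.asIdeal) ψ₀ ≠ 0)
    -- injectivity at the core vertex `∅` (n1011-p11's G5; interim: `…_of_S24`)
    (hinj : ∀ κ : Finset (HeightOneSpectrum (𝓞 ℚ)) →
        galoisCohomology (W.torsionGaloisModule ((3 : ℕ) : ℤ)) 1,
      D.IsKolyvaginSystem (propagatedSelmerStructureOne W 3) κ →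
      (inv.dualSelmerStructure (W.torsionGaloisModule ((3 : ℕ) : ℤ))
        (D.atLevel (propagatedSelmerStructureOne W 3) ∅)).selmerGroup = ⊥ →
      κ ∅ = 0 → ∀ m, κ m = 0) :
    ∃ x ∈ (W.kummerSelmerStructure ((3 : ℕ) : ℤ)).selmerGroup, x ≠ 0 := by
  haveI : Fact (Nat.Prime 3) := ⟨Nat.prime_three⟩
  -- (1) the dictionary: Kato-type classes `κ₀`, the functional `Λ`, the Kolyvagin system `κ'`
  obtain ⟨κ₀, Λ, -, ⟨κ', hI4⟩, -, hΛker, hdict⟩ :=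
    hDict hX hc3 h3 (by rw [ht, pow_zero]) hv₃ P hManin hΩ
  have hκ'KS : D.IsKolyvaginSystem (propagatedSelmerStructureOne W 3) κ'.1 :=
    (KolyvaginDatum.mem_kolyvaginSystems_iff D _ κ'.1).mp κ'.2
  -- at `∅`: `δ̃_1 = [0]⁺ ≡ 0`, so `κ'_∅` is a `3`-Selmer class
  have hSel0 : κ'.1 ∅ ∈ (W.kummerSelmerStructure ((3 : ℕ) : ℤ)).selmerGroup := by
    obtain ⟨u, ψ, -, hval⟩ := hdict ∅ D.isLevel_empty
    rw [kuriharaNumber_eq_ratModP_of_eq_one P.f 3 _ _ Finset.prod_empty ψ] at hval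
    exact apply_empty_mem_selmerGroup_kummer_of_dictionary_of_delta_eq_zero W hEP v₃ hv₃ κ₀ κ' hI4 Λ
      hΛker hval hzero
  -- at `n`: `Λ(loc κ₀ n) = u·3⁰·δ̃_n(ψ) ≠ 0` (ψ-independence), so `κ₀ n ≠ 0`
  have hκ₀n : κ₀ n ≠ 0 := by
    obtain ⟨u, ψ, hψ, hval⟩ := hdict n hn
    haveI : NeZero (∏ q ∈ n, Ideal.absNorm q.asIdeal) :=
      ⟨Finset.prod_ne_zero_iff.2 fun q _ => Assembly.absNorm_ne_zero q⟩
    have hNp : ∀ q ∈ n, (Ideal.absNorm q.asIdeal).Prime := fun q _ => FSComp.prime_absNorm_rat q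
    have hNinj := Assembly.absNorm_injOn (↑n : Set (HeightOneSpectrum (𝓞 ℚ)))
    have h1 := Shallow.forall_primeFactors_of_forall_mem _ n hNp hNinj hψ
    have h2 := Shallow.forall_primeFactors_of_forall_mem _ n hNp hNinj hψ₀
    have key := kuriharaNumber_eq_zero_iff_of_surjective P.f 3 (∏ q ∈ n, Ideal.absNorm q.asIdeal) h1 h2
    have hδ : kuriharaNumber P.f 3 (∏ q ∈ n, Ideal.absNorm q.asIdeal) ψ ≠ 0 := fun h0 =>
      hcert (key.2 h0)
    intro h0
    have : Λ (galoisCohomology.localization _ (Sum.inr v₃) 1 (κ₀ n)) = 0 := by rw [h0, map_zero, map_zero]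
    rw [hval, pow_zero, mul_one] at this
    exact hδ ((mul_eq_zero.1 this).resolve_left (Units.ne_zero u))
  -- §A: `κ'` is non-zero at some level `c ⊆ n`
  obtain ⟨c, -, hc, hκ'c⟩ := exists_subset_apply_ne_zero_of_congruence κ₀ κ'.1 hI4 hn hκ₀n
  -- (2) `κ'_∅ ≠ 0`: done
  by_cases h0e : κ'.1 ∅ ≠ 0
  · exact ⟨κ'.1 ∅, hSel0, h0e⟩
  push Not at h0e
  -- (3) `∅` a core vertex: injectivity kills `κ'`, contradiction
  by_cases hcore : (inv.dualSelmerStructure (W.torsionGaloisModule ((3 : ℕ) : ℤ))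
      (D.atLevel (propagatedSelmerStructureOne W 3) ∅)).selmerGroup = ⊥
  · exact absurd (hinj κ'.1 hκ'KS hcore h0e c) hκ'c
  -- (4) `∅` not a core vertex: `#H¹_{𝓕̄_can} = 3 · #H¹_{𝓕̄_can^*} ≥ 6` and `Λ ∘ loc_{v₃}` has kernel in `Sel₃`
  let T : Finset (HeightOneSpectrum (𝓞 ℚ)) := S.preimage Sum.inr Sum.inr_injective.injOn
  have h3T : ∀ v : HeightOneSpectrum (𝓞 ℚ), ((3 : ℕ) : 𝓞 ℚ) ∈ v.asIdeal → v ∈ T :=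
    fun v hv => Finset.mem_preimage.mpr (h3S v hv)
  have hbadT : ∀ v : HeightOneSpectrum (𝓞 ℚ), ¬ W.HasGoodReductionAt v → v ∈ T :=
    fun v hv => Finset.mem_preimage.mpr (hbadS v hv)
  have hχ := hasCoreRank_one_propagatedSelmerStructureOne_of_isPerfect_of_localEuler W inv hperf hsum
    hcompl hEP T h3T hbadT
  haveI hfin := finite_selmerGroup_propagatedSelmerStructureOne_three W
  haveI hfind := finite_dualSelmerGroup_propagatedSelmerStructureOne_three W inv hperf hsum hcompl hEP T
    h3T hbadT
  have h0 : D.atLevel (propagatedSelmerStructureOne W 3) ∅ = propagatedSelmerStructureOne W 3 :=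
    SelmerStructure.modify_empty _ D.transverse
  rw [h0] at hcore
  rw [LocalInvariants.HasCoreRank, pow_one] at hχ
  -- `#H* ≥ 2`
  have h2 : 2 ≤ Nat.card (inv.dualSelmerStructure (W.torsionGaloisModule ((3 : ℕ) : ℤ))
      (propagatedSelmerStructureOne W 3)).selmerGroup := by
    by_contra hlt
    push Not at hlt
    have h1 : Nat.card (inv.dualSelmerStructure (W.torsionGaloisModule ((3 : ℕ) : ℤ))
        (propagatedSelmerStructureOne W 3)).selmerGroup = 1 := by
      have hpos : 0 < Nat.card (inv.dualSelmerStructure (W.torsionGaloisModule ((3 : ℕ) : ℤ))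
          (propagatedSelmerStructureOne W 3)).selmerGroup := Nat.card_pos
      omega
    exact hcore (AddSubgroup.card_eq_one.1 h1)
  -- the hom `Λ ∘ loc_{v₃}` on `H¹_{𝓕̄_can}`
  set H := (propagatedSelmerStructureOne W 3).selmerGroup with hH
  let φ : H →+ ZMod 3 :=
    (Λ.comp (galoisCohomology.localization (W.torsionGaloisModule ((3 : ℕ) : ℤ)) (Sum.inr v₃) 1)).comp
      H.subtype
  -- its kernel lies in `Sel₃`
  have hker : ∀ x : H, φ x = 0 → (x : galoisCohomology _ 1) ∈
      (W.kummerSelmerStructure ((3 : ℕ) : ℤ)).selmerGroup := by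
    intro x hx
    have hxF : galoisCohomology.localization _ (Sum.inr v₃) 1 (x : galoisCohomology _ 1) ∈
        propagatedSelmerStructureOne W 3 (Sum.inr v₃) :=
      (SelmerStructure.mem_selmerGroup_iff _ _).1 x.2 (Sum.inr v₃)
    exact mem_selmerGroup_kummer_of_mem_propagated_of_localization_mem W hEP x.2 v₃ hv₃
      ((hΛker _ hxF).1 hx)
  -- `#H ≤ 3 · #ker φ`, so the kernel is non-trivial
  haveI : Finite φ.ker := Finite.of_injective _ (AddSubgroup.subtype_injective φ.ker)
  have hcardH : Nat.card H = Nat.card φ.ker * Nat.card φ.range := by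
    rw [← Nat.card_congr (QuotientAddGroup.quotientKerEquivRange φ).toEquiv]
    exact (AddSubgroup.card_eq_card_quotient_mul_card_addSubgroup φ.ker).trans (mul_comm _ _)
  have hrange : Nat.card φ.range ≤ 3 := by
    have h := AddSubgroup.card_le_card_addGroup φ.range
    rwa [Nat.card_zmod] at h
  have hker2 : 2 ≤ Nat.card φ.ker := by
    by_contra hlt
    push Not at hlt
    have hk1 : Nat.card φ.ker ≤ 1 := by omega
    have : Nat.card H ≤ 3 := by
      calc Nat.card H = Nat.card φ.ker * Nat.card φ.range := hcardH
        _ ≤ 1 * 3 := Nat.mul_le_mul hk1 hrange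
        _ = 3 := one_mul 3
    omega
  -- a non-zero element of the kernel
  haveI : Nontrivial φ.ker := by
    rw [← Finite.one_lt_card_iff_nontrivial]
    exact hker2
  obtain ⟨y, hy0⟩ := exists_ne (0 : φ.ker)
  refine ⟨((y : H) : galoisCohomology _ 1), hker (y : H) ((AddMonoidHom.mem_ker).1 y.2), ?_⟩
  intro hx
  apply hy0
  exact Subtype.ext (Subtype.ext hx)

/-- **END-m1, counting form: `#Sel^{(3)}(E/ℚ) ≠ 1`** (the currency of the certificate consumers
`…_of_card_selmerThree_eq_one` / of FILE B): same hypotheses as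
`exists_ne_zero_mem_selmerGroup_three_of_dictionaryOne_of_levelOne_certificate`; `Sel^{(3)}` is the
Selmer group of the Kummer structure (`selmerGroup_eq_selmerGroup_kummerSelmerStructure`).
[cite: Kim2022StructureSelmer, Thm. 3.13] [cite: Rubin2011, Thm. 2.8.4 (p. 25)] -/
theorem natCard_selmerGroup_three_ne_one_of_dictionaryOne_of_levelOne_certificate
    [W.IsGloballyMinimal] [Finite (geomTorsion W ((3 : ℕ) : ℤ))]
    (h3 : W.HasSurjectiveModNGaloisRep ((3 : ℕ) : ℤ))
    (inv : LocalInvariants ℚ 3) (hperf : inv.IsPerfect) (hsum : inv.SumLocalTermEqZero)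
    (hcompl : inv.SelmerComplement)
    (hEP : ∀ v : HeightOneSpectrum (𝓞 ℚ), localEulerPoincareCharacteristic (v.adicCompletion ℚ))
    (S : Finset (Place ℚ))
    (h3S : ∀ v : HeightOneSpectrum (𝓞 ℚ), ((3 : ℕ) : 𝓞 ℚ) ∈ v.asIdeal → (Sum.inr v : Place ℚ) ∈ S)
    (hbadS : ∀ v : HeightOneSpectrum (𝓞 ℚ), ¬ W.HasGoodReductionAt v → (Sum.inr v : Place ℚ) ∈ S)
    (D : KolyvaginDatum (W.torsionGaloisModule ((3 : ℕ) : ℤ)))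
    (v₃ : HeightOneSpectrum (𝓞 ℚ)) (hv₃ : ((3 : ℕ) : 𝓞 ℚ) ∈ v₃.asIdeal)
    (hDict : KatoKuriharaDictionaryThreeOneAt W 0 D v₃)
    (hX : Addv W 3) (hc3 : ¬ 3 ∣ (W.baseChange ℚ_[3]).localTamagawaNumber ℤ_[3])
    (ht : Nat.card {Q : (W.baseChange ℚ_[3]).toAffine.Point // (3 : ℕ) • Q = 0} = 1)
    {N : ℕ} [NeZero N] (P : ModularParametrizationData W N)
    (hManin : ¬ ((3 : ℕ) : ℤ) ∣ P.maninConstant)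
    (hΩ : ∃ u : ℚ, ‖(u : ℚ_[3])‖ = 1 ∧ W.realPeriodRat = u * plusPeriod P.f)
    (hzero : ratModP 3 (ratPlusSymbol P.f 0) = 0)
    (n : Finset (HeightOneSpectrum (𝓞 ℚ))) (hn : D.IsLevel n)
    {ψ₀ : (ℓ : ℕ) → (ZMod ℓ)ˣ →* Multiplicative (ZMod 3)}
    (hψ₀ : ∀ q ∈ n, Function.Surjective (ψ₀ (Ideal.absNorm q.asIdeal)))
    (hcert : haveI : NeZero (∏ q ∈ n, Ideal.absNorm q.asIdeal) :=
        ⟨Finset.prod_ne_zero_iff.2 fun q _ => Assembly.absNorm_ne_zero q⟩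
      kuriharaNumber P.f 3 (∏ q ∈ n, Ideal.absNorm q.asIdeal) ψ₀ ≠ 0)
    (hinj : ∀ κ : Finset (HeightOneSpectrum (𝓞 ℚ)) →
        galoisCohomology (W.torsionGaloisModule ((3 : ℕ) : ℤ)) 1,
      D.IsKolyvaginSystem (propagatedSelmerStructureOne W 3) κ →
      (inv.dualSelmerStructure (W.torsionGaloisModule ((3 : ℕ) : ℤ))
        (D.atLevel (propagatedSelmerStructureOne W 3) ∅)).selmerGroup = ⊥ →
      κ ∅ = 0 → ∀ m, κ m = 0) :
    Nat.card (W.selmerGroup (3 : ℤ)) ≠ 1 := by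
  obtain ⟨x, hx, hx0⟩ :=
    exists_ne_zero_mem_selmerGroup_three_of_dictionaryOne_of_levelOne_certificate W h3 inv hperf hsum
      hcompl hEP S h3S hbadS D v₃ hv₃ hDict hX hc3 ht P hManin hΩ hzero n hn hψ₀ hcert hinj
  intro h1
  rw [selmerGroup_eq_selmerGroup_kummerSelmerStructure] at h1
  have hbot : (W.kummerSelmerStructure ((3 : ℕ) : ℤ)).selmerGroup = ⊥ := AddSubgroup.card_eq_one.1 h1
  rw [hbot, AddSubgroup.mem_bot] at hx
  exact hx0 hx

end Summit.BirchSwinnertonDyer.Rank1Residual.GaloisImage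

end
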